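import Literature.Analysis.Complex.LaguerreTheorem
import HarnessLib

/-!
# Bernstein's inequality on the unit disk, Szegő's inequality `|nP − zP'| + |P'| ≤ n‖P‖`, the theorem of Lax (Erdős' conjecture), Malik's bound, Turán's lower bound, and self-inversive polynomials

Topic `Literature/Analysis/Complex`, namespace `Literature.Analysis.Complex.BernsteinLaxInequalities`.

Sources (held, read at the cited pages): T. Sheil-Small, *Complex Polynomials* (Cambridge Studies in
Advanced Mathematics 75, CUP 2002) §4.4 «Some inequalities for analytic and trigonometric polynomials»
and §5.3.2 (the polar-derivative road) [SheilSmall2002]; P. Borwein – T. Erdélyi, *Polynomials and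
Polynomial Inequalities* (GTM 161, Springer 1995) §5.1 and Appendix A5, E.16 [BorweinErdelyi1995];
P. D. Lax, Bull. AMS 50 (1944) [Lax1944]; M. A. Malik, J. London Math. Soc. (2) 1 (1969) [Malik1969].

Throughout `P ∈ ℂ[X]`, `‖P‖ := max_{|z|=1} |P(z)|` enters as a hypothesis
`hM : ∀ w, ‖w‖ = 1 → ‖P.eval w‖ ≤ M` (so every `M ≥ ‖P‖` is allowed), `U = {|z| < 1}`,
`𝕋 = {|z| = 1}`.

## What is proved (all statements are theorems; no named facts)

* `polar_ne_zero` — the engine, from LAGUERRE'S THEOREM of the tree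
  (`LaguerreTheorem.laguerre_exterior`): if `deg P = n ≥ 1` and `P ≠ 0` in `{|z| < R}`, then the
  polar derivative `nP(z) − (z − ζ)P'(z)` does not vanish for `|z|, |ζ| < R`
  [SheilSmall2002, §5.3.1–5.3.2 «if under the above conditions z₁ ∉ R, z ∉ R, then P₁(z) ≠ 0»].
* `norm_eval_le_of_forall_sphere` — `|P(z)| ≤ ‖P‖` on the closed disk (maximum modulus, Mathlib).
* `norm_polar_le` — **(5.81)** `|nP(z) − (z − ζ)P'(z)| ≤ n‖P‖` for `z, ζ ∈ U`.
* `szego_natDegree`, **`szego`** — **Sheil-Small's Theorem 4.4.2 in the form (5.82)**: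
  `|nP(z) − zP'(z)| + |P'(z)| ≤ n‖P‖` for `|z| ≤ 1` and every `n ≥ deg P`; `szego_eq_of_norm_eq` —
  the equality clause (4.167) at the points of `𝕋` where `|P| = ‖P‖`.
* **`bernstein`** — BERNSTEIN'S INEQUALITY (4.168) = [BorweinErdelyi1995, Cor. 5.1.6]:
  `|P'(z)| ≤ n‖P‖` for `|z| ≤ 1`.
* `mul_norm_derivative_le` — **(5.85)/(5.86)**: `P ≠ 0` in `{|z| < R}` ⟹ `R|P'(z)| ≤ |nP(z) − zP'(z)|`
  for `|z| < R` (`n = deg P ≥ 1`).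
* **`malik`** — MALIK'S THEOREM (5.87) = [BorweinErdelyi1995, A5 E.16 e]]: `P ≠ 0` in `{|z| < R}`,
  `R ≥ 1` ⟹ `|P'(z)| ≤ n/(1+R) · ‖P‖` on the closed unit disk.
* **`lax`** — LAX'S THEOREM (Erdős' conjecture) [Lax1944; SheilSmall2002, Thm 4.4.4;
  BorweinErdelyi1995, A5 E.16 a]]: `P ≠ 0` in `U` ⟹ `|P'(z)| ≤ (n/2)‖P‖` on the closed unit disk.
* `re_div_sub_ge` / **`turan_sum`** / `turan_of_roots_le` / **`turan`** — the lower bounds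
  [SheilSmall2002, §4.4.8 Problem 1 (4.190); BorweinErdelyi1995, A5 E.16 f], g]; Turán 1939]:
  for `|z| = 1` and ALL ZEROS IN THE CLOSED UNIT DISK, `|P'(z)| ≥ (Σ_k 1/(1+|z_k|)) |P(z)|`,
  hence `≥ n/(1+r)|P(z)|` when the zeros lie in `|w| ≤ r ≤ 1`, and `≥ (n/2)|P(z)|` (Turán).
  CORRECTION RECORDED: [BorweinErdelyi1995, A5 E.16 f]] prints the pointwise bound
  `Re(zP'(z)/P(z)) ≥ Σ 1/(1+|z_k|)` and the sup bound `‖P'‖ ≥ (Σ 1/(1+|z_k|))‖P‖` with NO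
  restriction on the zeros; both fail for zeros outside the closed disk — `counterexample_E16f`:
  `P = z² − 4` has `‖P'‖_D = 2 < (1/3 + 1/3)·5 = (Σ 1/(1+|z_k|))·‖P‖_D`. The statements here carry
  the hypothesis `|z_k| ≤ 1`, under which the printed proof is correct (and which is all that g] and
  Turán's inequality use).
* `norm_sub_eq_of_selfInversive` — **(4.173)–(4.174)**: for a SELF-INVERSIVE `P`
  (`a_k = conj a_{n−k}`, (4.170)) `|nP(z) − zP'(z)| = |P'(z)|` on `𝕋`; **`selfInversive_le`**,
  **`selfInversive_eq`** — Theorem 4.4.3: `‖P'‖ ≤ (n/2)‖P‖`, with equality `|P'(z₀)| = (n/2)‖P‖`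
  at every `z₀ ∈ 𝕋` where `|P(z₀)| = ‖P‖` (so `‖P'‖ = (n/2)‖P‖`).

## Proof road

Sheil-Small proves Theorem 4.4.2 by convolution with the Fejér kernel (§4.4.1, (4.164)); §5.3.2 of the
same book re-derives the (slightly stronger, interior) form (5.82) from LAGUERRE'S THEOREM via the polar
derivative, and derives Lax's theorem and (5.87) from it. We follow the §5.3.2 road throughout, since the
tree already holds Laguerre's theorem (`Literature/Analysis/Complex/LaguerreTheorem.lean`); the boundary
passages `|z| < 1 ⇝ |z| ≤ 1` are `le_on_closure`. The maximum modulus principle on the disk is Mathlib's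
`Complex.norm_le_of_forall_mem_frontier_norm_le`.

Not formalised here: the convolution inequality (4.164) for a general non-negative trigonometric
polynomial `T`; Szegő's `‖P'‖ ≤ n‖Re P‖` (4.188); [BorweinErdelyi1995, A5 E.16 c] (Kroó), d]
(Ankeny–Rivlin), h] (Govil)]. The trigonometric Bernstein and Bernstein–Szegő inequalities
(Sheil-Small Thm 4.4.7, Borwein–Erdélyi Thm 5.1.3–Cor 5.1.5) are the sequel file
`Literature/Analysis/Approximation/TrigonometricBernsteinInequality.lean`.

## References

* [SheilSmall2002] T. Sheil-Small, *Complex Polynomials*, CUP 2002, §4.4.2–4.4.4 (pp. 152–154),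
  §4.4.8 Problem 1 (p. 155), §5.3.2 (5.81)–(5.87) (p. 186) (held: `book:sheil-smallnd-complex-polynomials`).
* [BorweinErdelyi1995] P. Borwein, T. Erdélyi, *Polynomials and Polynomial Inequalities*, GTM 161,
  Springer 1995, Cor. 5.1.6 (p. 233), App. A5 E.16 (pp. 438–439) (held).
* [Lax1944] P. D. Lax, *Proof of a conjecture of P. Erdős on the derivative of a polynomial*,
  Bull. Amer. Math. Soc. 50 (1944) 509–513.
* [Malik1969] M. A. Malik, *On the derivative of a polynomial*, J. London Math. Soc. (2) 1 (1969) 57–60.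
-/

noncomputable section

open Polynomial Complex ComplexConjugate Metric Set Finset

namespace Literature.Analysis.Complex.BernsteinLaxInequalities

variable {p : ℂ[X]}

/-! ## The polar derivative does not vanish (Laguerre) -/

/-- **The polar derivative of a zero-free polynomial does not vanish.** If `deg P = n ≥ 1`, every zero
`w` of `P` has `|w| ≥ R`, and `|z| < R`, `|ζ| < R`, then `nP(z) − (z − ζ)P'(z) ≠ 0`. This is
Laguerre's theorem for the circular region `{|w| ≥ R}` (tree: `LaguerreTheorem.laguerre_exterior`,
the centre of mass `z − nP(z)/P'(z)` lies in the region) read as Sheil-Small reads it: «for z₁ ∉ R,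
P₁(z) has all its zeros in R», `P₁(z) = P(z) − (1/n)(z − z₁)P'(z)`.
[cite: SheilSmall2002, §5.3.1 (5.77)–(5.79) and §5.3.2 (p. 186)] -/
theorem polar_ne_zero (hn : 0 < p.natDegree) {R : ℝ} (hK : ∀ w ∈ p.roots, R ≤ ‖w‖)
    {z ζ : ℂ} (hz : ‖z‖ < R) (hζ : ‖ζ‖ < R) :
    (p.natDegree : ℂ) * p.eval z - (z - ζ) * p.derivative.eval z ≠ 0 := by
  have hp0 : p ≠ 0 := ne_zero_of_natDegree_gt hn
  have hpz : p.eval z ≠ 0 := by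
    intro h
    have hmem : z ∈ p.roots := (mem_roots hp0).2 h
    exact absurd (hK z hmem) (not_le.2 hz)
  by_cases h1 : p.derivative.eval z = 0
  · rw [h1, mul_zero, sub_zero]
    exact mul_ne_zero (Nat.cast_ne_zero.2 hn.ne') hpz
  · have hL := LaguerreTheorem.laguerre_exterior (p := p) hn (c := 0) (r := R)
      (fun w hw => by simpa using hK w hw) (by simpa using hz) h1
    intro h
    have hζ' : z - p.natDegree * p.eval z / p.derivative.eval z = ζ := by
      rw [sub_eq_zero] at h
      rw [mul_div_assoc] at *
      have : (p.natDegree : ℂ) * p.eval z / p.derivative.eval z = z - ζ := by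
        rw [div_eq_iff h1, h]
      rw [← mul_div_assoc, this]; ring
    rw [hζ', sub_zero] at hL
    exact absurd hL (not_le.2 hζ)

/-! ## Maximum modulus on the closed unit disk -/

/-- **Maximum modulus for a polynomial on the unit disk:** `|P(z)| ≤ M` for `|z| ≤ 1` as soon as
`|P| ≤ M` on the unit circle (Mathlib's `Complex.norm_le_of_forall_mem_frontier_norm_le`; Borwein–Erdélyi
quote «the maximum principle (see E.1 d] of Section 1.2)» at this point). [cite: BorweinErdelyi1995, §5.1 proof of Cor. 5.1.6 (p. 233)] -/
theorem norm_eval_le_of_forall_sphere {M : ℝ} (hM : ∀ w : ℂ, ‖w‖ = 1 → ‖p.eval w‖ ≤ M)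
    {z : ℂ} (hz : ‖z‖ ≤ 1) : ‖p.eval z‖ ≤ M := by
  have hd : DiffContOnCl ℂ (fun w : ℂ => p.eval w) (ball (0 : ℂ) 1) :=
    (Polynomial.differentiable p).diffContOnCl
  have h := Complex.norm_le_of_forall_mem_frontier_norm_le (f := fun w : ℂ => p.eval w)
    isBounded_ball hd (C := M)
    (fun w hw => hM w (by simpa [frontier_ball (0 : ℂ) one_ne_zero] using hw))
    (z := z) (by simpa [closure_ball (0 : ℂ) one_ne_zero] using hz)
  simpa using h

/-- The bound `M` in `|P| ≤ M` on the circle is non-negative. [folklore] -/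
private theorem bound_nonneg {M : ℝ} (hM : ∀ w : ℂ, ‖w‖ = 1 → ‖p.eval w‖ ≤ M) : 0 ≤ M :=
  (norm_nonneg _).trans (hM 1 (by simp))

/-- Boundary passage on the unit disk: a continuous real function bounded by `c` on the open unit disk
is bounded by `c` on the closed unit disk (`le_on_closure`). [folklore] -/
private theorem le_of_forall_ball {f : ℂ → ℝ} (hf : Continuous f) {c : ℝ}
    (h : ∀ ζ : ℂ, ‖ζ‖ < 1 → f ζ ≤ c) {ζ : ℂ} (hζ : ‖ζ‖ ≤ 1) : f ζ ≤ c := by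
  have hcl : ζ ∈ closure (ball (0 : ℂ) 1) := by
    rw [closure_ball (0 : ℂ) one_ne_zero]; simpa using hζ
  exact le_on_closure (f := f) (g := fun _ => c) (s := ball (0 : ℂ) 1)
    (fun x hx => h x (by simpa using hx)) hf.continuousOn continuousOn_const hcl

/-! ## (5.81) and Szegő's inequality (5.82) / Theorem 4.4.2 -/

/-- **(5.81)** If `deg P = n ≥ 1` and `|P| ≤ M` on the unit circle, then
`|nP(z) − (z − ζ)P'(z)| ≤ nM` for all `z, ζ` in the open unit disk: `P` omits every value `w` with
`|w| > M` in `U` (maximum modulus), so by Laguerre the polar derivative of `P − w` omits `0`, i.e.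
`nP(z) − (z − ζ)P'(z) ≠ nw`. [cite: SheilSmall2002, §5.3.2 (5.81) (p. 186)] -/
theorem norm_polar_le (hn : 0 < p.natDegree) {M : ℝ} (hM : ∀ w : ℂ, ‖w‖ = 1 → ‖p.eval w‖ ≤ M)
    {z ζ : ℂ} (hz : ‖z‖ < 1) (hζ : ‖ζ‖ < 1) :
    ‖(p.natDegree : ℂ) * p.eval z - (z - ζ) * p.derivative.eval z‖ ≤ p.natDegree * M := by
  by_contra! hlt
  set A : ℂ := (p.natDegree : ℂ) * p.eval z - (z - ζ) * p.derivative.eval z with hA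
  have hnR : (0 : ℝ) < p.natDegree := by exact_mod_cast hn
  have hnC : (p.natDegree : ℂ) ≠ 0 := by exact_mod_cast hn.ne'
  set w : ℂ := A / p.natDegree with hw
  have hMw : M < ‖w‖ := by
    rw [hw, norm_div, Complex.norm_natCast, lt_div_iff₀ hnR]; linarith
  -- `q = P − w` has the same degree and derivative, and no zeros in the open unit disk
  set q : ℂ[X] := p - C w with hq
  have hqn : q.natDegree = p.natDegree := natDegree_sub_C
  have hqd : q.derivative = p.derivative := by simp [hq]
  have hq0 : q ≠ 0 := by
    intro h; rw [h, natDegree_zero] at hqn; omega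
  have hroots : ∀ u ∈ q.roots, (1 : ℝ) ≤ ‖u‖ := by
    intro u hu
    have hu' : p.eval u = w := by
      have := (mem_roots hq0).1 hu
      simpa [hq, IsRoot, sub_eq_zero] using this
    by_contra! hu1
    have := norm_eval_le_of_forall_sphere hM hu1.le
    rw [hu'] at this
    linarith
  have key := polar_ne_zero (p := q) (hqn.symm ▸ hn) (R := 1) hroots hz hζ
  apply key
  rw [hqn, hqd]
  simp only [hq, eval_sub, eval_C]
  rw [mul_sub, hw, mul_div_cancel₀ _ hnC, hA]
  ring

/-- **Szegő's inequality in the open disk, `n = deg P ≥ 1`:** `|nP(z) − zP'(z)| + |P'(z)| ≤ nM` for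
`|z| < 1` — from (5.81), letting `ζ ∈ U` align `ζP'(z)` with `nP(z) − zP'(z)` (the passage
`|ζ| < 1 ⇝ |ζ| ≤ 1` is `le_on_closure`). [cite: SheilSmall2002, §5.3.2 (5.82) (p. 186)] -/
theorem szego_natDegree_ball (hn : 0 < p.natDegree) {M : ℝ}
    (hM : ∀ w : ℂ, ‖w‖ = 1 → ‖p.eval w‖ ≤ M) {z : ℂ} (hz : ‖z‖ < 1) :
    ‖(p.natDegree : ℂ) * p.eval z - z * p.derivative.eval z‖ + ‖p.derivative.eval z‖ ≤
      p.natDegree * M := by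
  set B : ℂ := (p.natDegree : ℂ) * p.eval z - z * p.derivative.eval z with hB
  set A : ℂ := p.derivative.eval z with hA
  -- (5.81) reads `‖B + ζ A‖ ≤ nM` for `|ζ| < 1`, hence for `|ζ| ≤ 1`
  have h581 : ∀ ζ : ℂ, ‖ζ‖ ≤ 1 → ‖B + ζ * A‖ ≤ p.natDegree * M := by
    intro ζ hζ
    refine le_of_forall_ball (f := fun ζ : ℂ => ‖B + ζ * A‖) (by fun_prop) ?_ hζ
    intro ζ' hζ'
    have := norm_polar_le hn hM hz hζ'
    have hrw : (p.natDegree : ℂ) * p.eval z - (z - ζ') * p.derivative.eval z = B + ζ' * A := by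
      rw [hB, hA]; ring
    rwa [hrw] at this
  by_cases hA0 : A = 0
  · have := h581 0 (by simp)
    simpa [hA0] using this
  by_cases hB0 : B = 0
  · -- take `ζ = |A|/A`
    have hζ : ‖((‖A‖ : ℂ) / A)‖ ≤ 1 := by
      rw [norm_div, Complex.norm_real, Real.norm_eq_abs, abs_norm, div_self (norm_ne_zero_iff.2 hA0)]
    have := h581 _ hζ
    rw [hB0, zero_add, div_mul_cancel₀ _ hA0, Complex.norm_real, Real.norm_eq_abs, abs_norm] at this
    simpa [hB0] using this
  · -- take `ζ = (B/|B|)(|A|/A)`, so that `B + ζA = B (1 + |A|/|B|)`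
    have hBn : (‖B‖ : ℂ) ≠ 0 := by exact_mod_cast norm_ne_zero_iff.2 hB0
    set ζ : ℂ := B / (‖B‖ : ℂ) * ((‖A‖ : ℂ) / A) with hζdef
    have hζ : ‖ζ‖ ≤ 1 := by
      rw [hζdef, norm_mul, norm_div, norm_div, Complex.norm_real, Complex.norm_real, Real.norm_eq_abs,
        Real.norm_eq_abs, abs_norm, abs_norm, div_self (norm_ne_zero_iff.2 hB0),
        div_self (norm_ne_zero_iff.2 hA0), mul_one]
    have hval : B + ζ * A = B * (1 + (‖A‖ : ℂ) / (‖B‖ : ℂ)) := by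
      rw [hζdef]; field_simp
    have hnorm : ‖B + ζ * A‖ = ‖B‖ + ‖A‖ := by
      rw [hval, norm_mul]
      have h1 : (1 : ℂ) + (‖A‖ : ℂ) / (‖B‖ : ℂ) = ((1 + ‖A‖ / ‖B‖ : ℝ) : ℂ) := by push_cast; ring
      rw [h1, Complex.norm_real, Real.norm_eq_abs,
        abs_of_nonneg (by positivity : (0 : ℝ) ≤ 1 + ‖A‖ / ‖B‖)]
      field_simp
    have := h581 ζ hζ
    rwa [hnorm] at this

/-- **Szegő's inequality (Sheil-Small's Theorem 4.4.2 in the form (5.82)):** for a polynomial `P` of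
degree at most `n` with `|P| ≤ M` on the unit circle,
`|nP(z) − zP'(z)| + |P'(z)| ≤ nM` for every `|z| ≤ 1`. (On the circle `|zP'(z)| = |P'(z)|`, which is
the printed (4.166); the book obtains (4.166) from the Fejér-kernel case of the convolution inequality
(4.164) and re-derives (5.82) from Laguerre's theorem in §5.3.2 — the road taken here.)
[cite: SheilSmall2002, §4.4.2 Theorem (4.166) (p. 152) and §5.3.2 (5.82) (p. 186)] -/
theorem szego {n : ℕ} (hpn : p.natDegree ≤ n) {M : ℝ} (hM : ∀ w : ℂ, ‖w‖ = 1 → ‖p.eval w‖ ≤ M)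
    {z : ℂ} (hz : ‖z‖ ≤ 1) :
    ‖(n : ℂ) * p.eval z - z * p.derivative.eval z‖ + ‖p.derivative.eval z‖ ≤ n * M := by
  have hM0 : 0 ≤ M := bound_nonneg hM
  have hPz : ‖p.eval z‖ ≤ M := norm_eval_le_of_forall_sphere hM hz
  rcases Nat.eq_zero_or_pos p.natDegree with h0 | hpos
  · -- constant polynomial
    rw [eq_C_of_natDegree_eq_zero h0] at hPz ⊢
    simp only [eval_C, derivative_C, eval_zero, mul_zero, sub_zero, norm_zero, add_zero, norm_mul,
      Complex.norm_natCast] at hPz ⊢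
    exact mul_le_mul_of_nonneg_left hPz (Nat.cast_nonneg n)
  · -- degree `m ≥ 1`: the `m`-inequality in the closed disk, plus `(n − m)|P(z)| ≤ (n − m)M`
    have hm : ‖(p.natDegree : ℂ) * p.eval z - z * p.derivative.eval z‖ + ‖p.derivative.eval z‖ ≤
        p.natDegree * M :=
      le_of_forall_ball (f := fun z : ℂ =>
          ‖(p.natDegree : ℂ) * p.eval z - z * p.derivative.eval z‖ + ‖p.derivative.eval z‖)
        (by fun_prop) (fun ζ hζ => szego_natDegree_ball hpos hM hζ) hz
    have hsplit : (n : ℂ) * p.eval z - z * p.derivative.eval z =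
        ((n - p.natDegree : ℕ) : ℂ) * p.eval z +
          ((p.natDegree : ℂ) * p.eval z - z * p.derivative.eval z) := by
      rw [Nat.cast_sub hpn]; ring
    have hnm : (n : ℝ) = ((n - p.natDegree : ℕ) : ℝ) + p.natDegree := by
      rw [Nat.cast_sub hpn]; ring
    calc ‖(n : ℂ) * p.eval z - z * p.derivative.eval z‖ + ‖p.derivative.eval z‖
        ≤ (‖((n - p.natDegree : ℕ) : ℂ) * p.eval z‖ +
            ‖(p.natDegree : ℂ) * p.eval z - z * p.derivative.eval z‖) + ‖p.derivative.eval z‖ := by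
          rw [hsplit]; gcongr; exact norm_add_le _ _
      _ = ((n - p.natDegree : ℕ) : ℝ) * ‖p.eval z‖ +
            (‖(p.natDegree : ℂ) * p.eval z - z * p.derivative.eval z‖ + ‖p.derivative.eval z‖) := by
          rw [norm_mul, Complex.norm_natCast]; ring
      _ ≤ ((n - p.natDegree : ℕ) : ℝ) * M + p.natDegree * M := by gcongr
      _ = n * M := by rw [hnm]; ring

/-- The elementary reverse inequality behind the equality clause:
`n|P(z)| ≤ |nP(z) − zP'(z)| + |P'(z)|` for `|z| ≤ 1`. [cite: SheilSmall2002, §4.4.2 (4.167) (p. 152)] -/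
theorem norm_le_szego_sum (n : ℕ) {z : ℂ} (hz : ‖z‖ ≤ 1) :
    n * ‖p.eval z‖ ≤ ‖(n : ℂ) * p.eval z - z * p.derivative.eval z‖ + ‖p.derivative.eval z‖ := by
  calc (n : ℝ) * ‖p.eval z‖ = ‖(n : ℂ) * p.eval z‖ := by rw [norm_mul, Complex.norm_natCast]
    _ = ‖((n : ℂ) * p.eval z - z * p.derivative.eval z) + z * p.derivative.eval z‖ := by
        rw [sub_add_cancel]
    _ ≤ ‖(n : ℂ) * p.eval z - z * p.derivative.eval z‖ + ‖z * p.derivative.eval z‖ := norm_add_le _ _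
    _ ≤ ‖(n : ℂ) * p.eval z - z * p.derivative.eval z‖ + ‖p.derivative.eval z‖ := by
        rw [norm_mul]
        gcongr
        exact mul_le_of_le_one_left (norm_nonneg _) hz

/-- **Equality clause of Theorem 4.4.2:** at each point `z` of the unit circle where `|P(z)| = M = ‖P‖`
one has `|nP(z) − zP'(z)| + |P'(z)| = nM`. [cite: SheilSmall2002, §4.4.2 Theorem, (4.166)–(4.167) (p. 152)] -/
theorem szego_eq_of_norm_eq {n : ℕ} (hpn : p.natDegree ≤ n) {M : ℝ}
    (hM : ∀ w : ℂ, ‖w‖ = 1 → ‖p.eval w‖ ≤ M) {z : ℂ} (hz : ‖z‖ = 1) (hzM : ‖p.eval z‖ = M) :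
    ‖(n : ℂ) * p.eval z - z * p.derivative.eval z‖ + ‖p.derivative.eval z‖ = n * M := by
  refine le_antisymm (szego hpn hM hz.le) ?_
  rw [← hzM]
  exact norm_le_szego_sum n hz.le

/-! ## Bernstein's inequality on the unit disk -/

/-- **Bernstein's inequality on the unit disk** (M. Riesz 1914, S. N. Bernstein): for `P` of degree at
most `n` with `|P| ≤ M` on the unit circle, `|P'(z)| ≤ nM` for all `|z| ≤ 1` — sharp for `P = zⁿ`.
[cite: SheilSmall2002, §4.4.2 (4.168) (p. 152)] [cite: BorweinErdelyi1995, §5.1 Cor. 5.1.6 (p. 233)] -/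
theorem bernstein {n : ℕ} (hpn : p.natDegree ≤ n) {M : ℝ}
    (hM : ∀ w : ℂ, ‖w‖ = 1 → ‖p.eval w‖ ≤ M) {z : ℂ} (hz : ‖z‖ ≤ 1) :
    ‖p.derivative.eval z‖ ≤ n * M :=
  le_of_add_le_of_nonneg_right (szego hpn hM hz) (norm_nonneg _)

/-- Bernstein's inequality with `n = deg P`. [cite: SheilSmall2002, §4.4.2 (4.168) (p. 152)] -/
theorem bernstein_natDegree {M : ℝ} (hM : ∀ w : ℂ, ‖w‖ = 1 → ‖p.eval w‖ ≤ M) {z : ℂ}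
    (hz : ‖z‖ ≤ 1) : ‖p.derivative.eval z‖ ≤ p.natDegree * M :=
  bernstein le_rfl hM hz

/-- Sharpness of Bernstein's inequality: for `P = zⁿ` (`‖P‖ = 1`) one has `|P'(1)| = n`.
[cite: SheilSmall2002, §4.4.2 «This inequality is sharp for P(z) = zⁿ» (p. 152)] -/
theorem bernstein_sharp (n : ℕ) :
    (∀ w : ℂ, ‖w‖ = 1 → ‖(X ^ n : ℂ[X]).eval w‖ ≤ 1) ∧
      ‖(derivative (X ^ n : ℂ[X])).eval 1‖ = n * 1 := by
  refine ⟨fun w hw => by simp [hw], ?_⟩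
  simp [derivative_X_pow]

/-- **Iterated Bernstein inequality:** `|P^{(k)}(z)| ≤ n(n−1)⋯(n−k+1)·M` on the closed disk
(induction on `k`, since `deg P' ≤ n − 1`; the trigonometric analogue is Borwein–Erdélyi's Thm 5.1.4
`‖t^{(m)}‖ ≤ nᵐ‖t‖`). [cite: BorweinErdelyi1995, §5.1 Thm 5.1.4 and Cor. 5.1.6 (p. 233)] -/
theorem bernstein_iterate {n : ℕ} (hpn : p.natDegree ≤ n) {M : ℝ}
    (hM : ∀ w : ℂ, ‖w‖ = 1 → ‖p.eval w‖ ≤ M) (k : ℕ) {z : ℂ} (hz : ‖z‖ ≤ 1) :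
    ‖(derivative^[k] p).eval z‖ ≤ (n.descFactorial k : ℝ) * M := by
  induction k generalizing p n M z with
  | zero => simpa using norm_eval_le_of_forall_sphere hM hz
  | succ k ih =>
    rw [Function.iterate_succ_apply]
    have hd : (derivative p).natDegree ≤ n - 1 :=
      (natDegree_derivative_le p).trans (Nat.sub_le_sub_right hpn 1)
    have hM' : ∀ w : ℂ, ‖w‖ = 1 → ‖(derivative p).eval w‖ ≤ n * M :=
      fun w hw => bernstein hpn hM hw.le
    have := ih hd hM' hz
    calc ‖(derivative^[k] (derivative p)).eval z‖ ≤ ((n - 1).descFactorial k : ℝ) * (n * M) := this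
      _ = (n.descFactorial (k + 1) : ℝ) * M := by
          cases n with
          | zero => simp
          | succ m =>
            rw [Nat.add_sub_cancel, Nat.succ_descFactorial_succ, Nat.cast_mul]; ring

/-! ## (5.85)/(5.86): zero-free polynomials -/

/-- **(5.85)/(5.86)** If `deg P = n ≥ 1`, `P` has no zeros in `{|w| < R}` and `|z| < R`, then
`R·|P'(z)| ≤ |nP(z) − zP'(z)|`: otherwise `ζ := −(nP(z) − zP'(z))/P'(z)` has `|ζ| < R` and kills the
polar derivative, contradicting `polar_ne_zero`. [cite: SheilSmall2002, §5.3.2 (5.85)–(5.86) (p. 186)] -/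
theorem mul_norm_derivative_le (hn : 0 < p.natDegree) {R : ℝ} (hK : ∀ w ∈ p.roots, R ≤ ‖w‖)
    {z : ℂ} (hz : ‖z‖ < R) :
    R * ‖p.derivative.eval z‖ ≤ ‖(p.natDegree : ℂ) * p.eval z - z * p.derivative.eval z‖ := by
  set B : ℂ := (p.natDegree : ℂ) * p.eval z - z * p.derivative.eval z with hB
  set A : ℂ := p.derivative.eval z with hA
  by_contra! hlt
  have hA0 : A ≠ 0 := by
    intro h; rw [h, norm_zero, mul_zero] at hlt; exact absurd hlt (not_lt.2 (norm_nonneg _))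
  have hR : 0 < R := (norm_nonneg _).trans_lt hz
  set ζ : ℂ := -B / A with hζ
  have hζR : ‖ζ‖ < R := by
    rw [hζ, norm_div, norm_neg, div_lt_iff₀ (norm_pos_iff.2 hA0)]; linarith
  have key := polar_ne_zero hn hK hz hζR
  apply key
  have : (p.natDegree : ℂ) * p.eval z - (z - ζ) * p.derivative.eval z = B + ζ * A := by
    rw [hB, hA]; ring
  rw [this, hζ, div_mul_cancel₀ _ hA0, add_neg_cancel]

/-! ## Malik's theorem and Lax's theorem -/

/-- **Malik's theorem** [Malik1969] (Sheil-Small (5.87); Borwein–Erdélyi A5 E.16 e]): if `P` has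
degree at most `n`, no zeros in the disk `{|w| < R}` with `R ≥ 1`, and `|P| ≤ M` on the unit circle,
then `|P'(z)| ≤ n/(1+R) · M` for all `|z| ≤ 1`. Proof as printed: (5.86) `|nP − zP'| ≥ R|P'|` and
(5.82) `|nP − zP'| + |P'| ≤ nM` give `(1+R)|P'| ≤ nM` in `U`; the circle by continuity.
[cite: SheilSmall2002, §5.3.2 (5.86)–(5.87) (p. 186)] [cite: BorweinErdelyi1995, A5 E.16 e] (p. 439)] [cite: Malik1969, Theorem] -/
theorem malik {n : ℕ} (hpn : p.natDegree ≤ n) {R : ℝ} (hR : 1 ≤ R)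
    (hK : ∀ w ∈ p.roots, R ≤ ‖w‖) {M : ℝ} (hM : ∀ w : ℂ, ‖w‖ = 1 → ‖p.eval w‖ ≤ M)
    {z : ℂ} (hz : ‖z‖ ≤ 1) : ‖p.derivative.eval z‖ ≤ n / (1 + R) * M := by
  have hM0 : 0 ≤ M := bound_nonneg hM
  have hR1 : 0 < 1 + R := by linarith
  rcases Nat.eq_zero_or_pos p.natDegree with h0 | hpos
  · rw [eq_C_of_natDegree_eq_zero h0, derivative_C, eval_zero, norm_zero]; positivity
  -- interior estimate with `m = deg P`, then boundary passage and `m ≤ n`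
  have hin : ∀ ζ : ℂ, ‖ζ‖ < 1 → ‖p.derivative.eval ζ‖ ≤ p.natDegree / (1 + R) * M := by
    intro ζ hζ
    have h1 := mul_norm_derivative_le hpos hK (lt_of_lt_of_le hζ hR)
    have h2 := szego_natDegree_ball hpos hM hζ
    rw [div_mul_eq_mul_div, le_div_iff₀ hR1]
    linarith
  have hcl : ‖p.derivative.eval z‖ ≤ p.natDegree / (1 + R) * M :=
    le_of_forall_ball (f := fun ζ : ℂ => ‖p.derivative.eval ζ‖) (by fun_prop) hin hz
  refine hcl.trans ?_
  gcongr

/-- **Lax's theorem (Erdős' conjecture, 1944).** If `P` has degree at most `n`, no zeros in the open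
unit disk, and `|P| ≤ M` on the unit circle, then `|P'(z)| ≤ (n/2)·M` for all `|z| ≤ 1` — sharp for
`P = 1 + zⁿ`. (Malik's theorem with `R = 1`; Sheil-Small's own proof of Thm 4.4.4 uses
`Re(zP'/(nP)) < 1/2` in `U`, his §5.3.2 the polar derivative — both give `|zP'| ≤ |nP − zP'|`.)
[cite: Lax1944, Theorem (p. 509)] [cite: SheilSmall2002, §4.4.4 Theorem (4.176)–(4.177) (p. 153) and §5.3.2 (5.84)–(5.85) (p. 186)] [cite: BorweinErdelyi1995, A5 E.16 a] (p. 438)] -/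
theorem lax {n : ℕ} (hpn : p.natDegree ≤ n) (hK : ∀ w ∈ p.roots, 1 ≤ ‖w‖) {M : ℝ}
    (hM : ∀ w : ℂ, ‖w‖ = 1 → ‖p.eval w‖ ≤ M) {z : ℂ} (hz : ‖z‖ ≤ 1) :
    ‖p.derivative.eval z‖ ≤ n / 2 * M := by
  have := malik hpn le_rfl hK hM hz
  norm_num at this
  exact this

/-- Lax's theorem with `n = deg P`. [cite: Lax1944, Theorem (p. 509)] [cite: SheilSmall2002, §4.4.4 Theorem (p. 153)] -/
theorem lax_natDegree (hK : ∀ w ∈ p.roots, 1 ≤ ‖w‖) {M : ℝ}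
    (hM : ∀ w : ℂ, ‖w‖ = 1 → ‖p.eval w‖ ≤ M) {z : ℂ} (hz : ‖z‖ ≤ 1) :
    ‖p.derivative.eval z‖ ≤ p.natDegree / 2 * M :=
  lax le_rfl hK hM hz

/-- The zero-free hypothesis of Lax's theorem in terms of values: `P(w) ≠ 0` for `|w| < 1` iff every
member of `P.roots` has modulus `≥ 1` (for `P ≠ 0`) — the printed hypothesis «P(z) ≠ 0 (z ∈ U)» (4.176)
in the form used by `lax`. [cite: SheilSmall2002, §4.4.4 (4.176) (p. 153)] -/
theorem forall_roots_one_le_iff (hp : p ≠ 0) :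
    (∀ w ∈ p.roots, (1 : ℝ) ≤ ‖w‖) ↔ ∀ w : ℂ, ‖w‖ < 1 → p.eval w ≠ 0 := by
  constructor
  · intro h w hw h0
    exact absurd (h w ((mem_roots hp).2 h0)) (not_le.2 hw)
  · intro h w hw
    by_contra! hlt
    exact h w hlt ((mem_roots hp).1 hw)

/-- **Sharpness of Lax's theorem:** for `P = 1 + zⁿ` (no zeros in `U`, `‖P‖ = 2` attained at `z = 1`)
`|P'(1)| = n = (n/2)·2`. [cite: SheilSmall2002, §4.4.3 «The example P(z) = 1 + zⁿ» (p. 153)] [cite: BorweinErdelyi1995, A5 E.16 a] (p. 438)] -/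
theorem lax_sharp (n : ℕ) :
    (∀ w : ℂ, ‖w‖ = 1 → ‖(1 + X ^ n : ℂ[X]).eval w‖ ≤ 2) ∧ ‖(1 + X ^ n : ℂ[X]).eval 1‖ = 2 ∧
      ‖(derivative (1 + X ^ n : ℂ[X])).eval 1‖ = n / 2 * 2 := by
  refine ⟨fun w hw => ?_, ?_, ?_⟩
  · simp only [eval_add, eval_one, eval_pow, eval_X]
    calc ‖(1 : ℂ) + w ^ n‖ ≤ ‖(1 : ℂ)‖ + ‖w ^ n‖ := norm_add_le _ _
      _ = 2 := by rw [norm_pow, hw]; norm_num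
  · simp only [eval_add, eval_one, eval_pow, eval_X, one_pow]; norm_num
  · simp [derivative_X_pow]

/-! ## Turán's lower bound (zeros in the closed unit disk) -/

/-- The pointwise estimate behind Turán's inequality: for `|z| = 1`, `|w| ≤ 1`, `w ≠ z`,
`Re(z/(z − w)) ≥ 1/(1 + |w|)` (with `u = w z̄`: `Re 1/(1−u) − 1/(1+|u|) = (1−|u|)(|u| + Re u)/((1+|u|)|1−u|²) ≥ 0`;
this requires `|w| ≤ 1` — see `counterexample_E16f`).
[cite: BorweinErdelyi1995, A5 E.16 f] (p. 439)] [cite: SheilSmall2002, §4.4.4 proof, (4.179) (p. 153)] -/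
theorem re_div_sub_ge {z w : ℂ} (hz : ‖z‖ = 1) (hw : ‖w‖ ≤ 1) (hzw : w ≠ z) :
    1 / (1 + ‖w‖) ≤ (z / (z - w)).re := by
  have hz0 : z ≠ 0 := by rintro rfl; simp at hz
  -- `z/(z − w) = 1/(1 − u)` with `u = w/z`, `|u| = |w|`
  set u : ℂ := w / z with hu
  have hun : ‖u‖ = ‖w‖ := by rw [hu, norm_div, hz, div_one]
  have hu1 : u ≠ 1 := by
    intro h; rw [hu, div_eq_one_iff_eq hz0] at h; exact hzw h
  have hzu : z / (z - w) = 1 / (1 - u) := by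
    rw [hu]; field_simp
  rw [hzu, ← hun]
  have h1u : (1 : ℂ) - u ≠ 0 := sub_ne_zero.2 (Ne.symm hu1)
  have hpos : 0 < ‖(1 : ℂ) - u‖ ^ 2 := by positivity
  -- real and imaginary parts
  have hre : ((1 : ℂ) / (1 - u)).re = (1 - u.re) / ‖(1 : ℂ) - u‖ ^ 2 := by
    rw [one_div, Complex.inv_re, Complex.normSq_eq_norm_sq]; simp
  rw [hre, div_le_div_iff₀ (by positivity) hpos]
  have hn2 : ‖(1 : ℂ) - u‖ ^ 2 = (1 - u.re) ^ 2 + u.im ^ 2 := by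
    rw [← Complex.normSq_eq_norm_sq, Complex.normSq_apply]; simp; ring
  have hu2 : ‖u‖ ^ 2 = u.re ^ 2 + u.im ^ 2 := by
    rw [← Complex.normSq_eq_norm_sq, Complex.normSq_apply]; ring
  have hre_le : -‖u‖ ≤ u.re := by
    have := Complex.abs_re_le_norm u; rw [abs_le] at this; exact this.1
  have hu0 : 0 ≤ ‖u‖ := norm_nonneg u
  rw [← hun] at hw
  nlinarith [mul_nonneg (sub_nonneg.2 hw) (add_nonneg hu0 (by linarith : 0 ≤ u.re + ‖u‖))]

/-- **Turán-type inequality with the sum over the zeros** (Borwein–Erdélyi A5 E.16 f], for zeros in the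
CLOSED UNIT DISK): if `P ≠ 0` has all its zeros `z_k` (listed with multiplicity) in `|w| ≤ 1`, then for
`|z| = 1`, `(Σ_k 1/(1+|z_k|))·|P(z)| ≤ |P'(z)|`, by `Re(zP'(z)/P(z)) = Σ_k Re(z/(z − z_k))` and
`re_div_sub_ge`. [cite: BorweinErdelyi1995, A5 E.16 f] (p. 439)] -/
theorem turan_sum (hp : p ≠ 0) (hK : ∀ w ∈ p.roots, ‖w‖ ≤ 1) {z : ℂ} (hz : ‖z‖ = 1) :
    (p.roots.map fun w => 1 / (1 + ‖w‖)).sum * ‖p.eval z‖ ≤ ‖p.derivative.eval z‖ := by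
  by_cases h0 : p.eval z = 0
  · rw [h0, norm_zero, mul_zero]; exact norm_nonneg _
  -- logarithmic derivative: `P'(z)/P(z) = Σ 1/(z − w)`
  have hlog : p.derivative.eval z / p.eval z = (p.roots.map fun w => 1 / (z - w)).sum :=
    (IsAlgClosed.splits p).eval_derivative_div_eval_of_ne_zero h0
  have hsum : (z * (p.derivative.eval z / p.eval z)).re =
      (p.roots.map fun w => (z / (z - w)).re).sum := by
    have hre : ∀ s : Multiset ℂ, s.sum.re = (s.map Complex.re).sum := fun s =>
      Multiset.induction_on s (by simp) (fun a s ih => by simp [Multiset.sum_cons, ih])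
    rw [hlog, ← Multiset.sum_map_mul_left, hre, Multiset.map_map]
    refine congrArg _ (Multiset.map_congr rfl fun w _ => ?_)
    simp only [Function.comp_apply, mul_one_div]
  have hle : (p.roots.map fun w => 1 / (1 + ‖w‖)).sum ≤
      (p.roots.map fun w => (z / (z - w)).re).sum := by
    refine Multiset.sum_map_le_sum_map _ _ fun w hw => re_div_sub_ge hz (hK w hw) ?_
    rintro rfl
    exact h0 ((mem_roots hp).1 hw)
  have hPz : 0 < ‖p.eval z‖ := norm_pos_iff.2 h0
  calc (p.roots.map fun w => 1 / (1 + ‖w‖)).sum * ‖p.eval z‖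
      ≤ (z * (p.derivative.eval z / p.eval z)).re * ‖p.eval z‖ := by
        rw [← hsum] at hle; gcongr
    _ ≤ ‖z * (p.derivative.eval z / p.eval z)‖ * ‖p.eval z‖ := by
        gcongr; exact Complex.re_le_norm _
    _ = ‖p.derivative.eval z‖ := by
        rw [norm_mul, hz, one_mul, norm_div, div_mul_cancel₀ _ hPz.ne']

/-- **Borwein–Erdélyi A5 E.16 g]:** if all zeros of `P` (`deg P = n`) lie in `|w| ≤ r` with `r ≤ 1`,
then `n/(1+r)·|P(z)| ≤ |P'(z)|` for `|z| = 1` (hence `‖P'‖ ≥ n/(1+r)‖P‖`).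
[cite: BorweinErdelyi1995, A5 E.16 g] (p. 439)] -/
theorem turan_of_roots_le {r : ℝ} (hr : r ≤ 1) (hK : ∀ w ∈ p.roots, ‖w‖ ≤ r) {z : ℂ}
    (hz : ‖z‖ = 1) : p.natDegree / (1 + r) * ‖p.eval z‖ ≤ ‖p.derivative.eval z‖ := by
  by_cases hp : p = 0
  · subst hp; simp
  have hK1 : ∀ w ∈ p.roots, ‖w‖ ≤ 1 := fun w hw => (hK w hw).trans hr
  refine le_trans ?_ (turan_sum hp hK1 hz)
  gcongr
  -- `n/(1+r) ≤ Σ 1/(1+|w|)` termwise, `card roots = n`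
  have hcard : Multiset.card p.roots = p.natDegree :=
    ((IsAlgClosed.splits p).natDegree_eq_card_roots).symm
  have hr0 : ∀ w ∈ p.roots, 0 < 1 + r := fun w hw =>
    lt_of_lt_of_le (by positivity : (0 : ℝ) < 1 + ‖w‖) (by linarith [hK w hw])
  calc (p.natDegree : ℝ) / (1 + r) = (p.roots.map fun _ => 1 / (1 + r)).sum := by
        rw [Multiset.map_const', Multiset.sum_replicate, hcard, nsmul_eq_mul]; ring
    _ ≤ (p.roots.map fun w => 1 / (1 + ‖w‖)).sum := by
        refine Multiset.sum_map_le_sum_map _ _ fun w hw => ?_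
        exact one_div_le_one_div_of_le (by positivity) (by linarith [hK w hw])

/-- **Turán's inequality** (P. Turán 1939; Sheil-Small §4.4.8 Problem 1; Borwein–Erdélyi E.16 g] with
`r = 1`): if all zeros of `P` (`deg P = n`) lie in the closed unit disk, then
`(n/2)|P(z)| ≤ |P'(z)|` at every point of the unit circle; in particular `‖P'‖ ≥ (n/2)‖P‖`.
[cite: SheilSmall2002, §4.4.8 Problem 1 (4.190) (p. 155)] [cite: BorweinErdelyi1995, A5 E.16 g] (p. 439)] -/
theorem turan (hK : ∀ w ∈ p.roots, ‖w‖ ≤ 1) {z : ℂ} (hz : ‖z‖ = 1) :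
    p.natDegree / 2 * ‖p.eval z‖ ≤ ‖p.derivative.eval z‖ := by
  have := turan_of_roots_le le_rfl hK hz
  norm_num at this
  exact this

/-- Turán's inequality in sup form: at a point `z₀ ∈ 𝕋` where `|P(z₀)| = M = ‖P‖`, `|P'(z₀)| ≥ (n/2)M`,
so `‖P'‖ ≥ (n/2)‖P‖`. [cite: SheilSmall2002, §4.4.8 Problem 1 (4.190) (p. 155)] -/
theorem turan_sup (hK : ∀ w ∈ p.roots, ‖w‖ ≤ 1) {M : ℝ} {z₀ : ℂ} (hz₀ : ‖z₀‖ = 1)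
    (hM : ‖p.eval z₀‖ = M) : p.natDegree / 2 * M ≤ ‖p.derivative.eval z₀‖ := by
  rw [← hM]; exact turan hK hz₀

/-- **Correction recorded for Borwein–Erdélyi A5 E.16 f].** The exercise prints
`‖p'‖_D ≥ (Σ_k 1/(1+|z_k|)) ‖p‖_D` and, in its proof, `Re(zp'(z)/p(z)) ≥ Σ_k 1/(1+|z_k|)` on `∂D`,
for an ARBITRARY `p = c∏(z − z_k)`. Both fail when zeros lie outside the closed unit disk:
for `p = z² − 4` (zeros `±2`, `Σ 1/(1+|z_k|) = 2/3`) one has `|p'(z)| = 2|z| ≤ 2` on the closed disk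
while `|p(i)| = 5`, and `2 < (2/3)·5`; at `z = 1` moreover `Re(zp'/p) = −2/3 < 2/3`.
(`turan_sum` carries the hypothesis `|z_k| ≤ 1`, which is what g] and Turán's inequality use.)
[cite: BorweinErdelyi1995, A5 E.16 f] (p. 439)] -/
theorem counterexample_E16f :
    (X ^ 2 - C 4 : ℂ[X]).roots = {2, -2} ∧
    (∀ z : ℂ, ‖z‖ ≤ 1 → ‖(derivative (X ^ 2 - C 4 : ℂ[X])).eval z‖ ≤ 2) ∧
    ‖(X ^ 2 - C 4 : ℂ[X]).eval I‖ = 5 ∧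
    (2 : ℝ) < (1 / (1 + ‖(2 : ℂ)‖) + 1 / (1 + ‖(-2 : ℂ)‖)) * 5 ∧
    ((1 : ℂ) * ((derivative (X ^ 2 - C 4 : ℂ[X])).eval 1 / (X ^ 2 - C 4 : ℂ[X]).eval 1)).re
      < 1 / (1 + ‖(2 : ℂ)‖) + 1 / (1 + ‖(-2 : ℂ)‖) := by
  have hd : derivative (X ^ 2 - C 4 : ℂ[X]) = C 2 * X := by
    rw [derivative_sub, derivative_X_pow, derivative_C, sub_zero]; norm_num
  refine ⟨?_, ?_, ?_, ?_, ?_⟩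
  · have h : (X ^ 2 - C 4 : ℂ[X]) = (X - C 2) * (X - C (-2)) := by
      rw [map_neg, sub_neg_eq_add]; ring_nf; rw [← C_pow]; norm_num
    rw [h, roots_mul, roots_X_sub_C, roots_X_sub_C]
    · rfl
    · rw [← h]
      intro h0
      have := congrArg (fun q : ℂ[X] => q.coeff 2) h0
      simp [coeff_X_pow] at this
  · intro z hz
    rw [hd, eval_mul, eval_C, eval_X, norm_mul]
    have h2 : ‖(2 : ℂ)‖ = 2 := by norm_num
    rw [h2]
    nlinarith [norm_nonneg z]
  · simp only [eval_sub, eval_pow, eval_X, eval_C, I_sq]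
    rw [show (-1 : ℂ) - 4 = ((-5 : ℝ) : ℂ) by push_cast; norm_num, Complex.norm_real]
    norm_num
  · norm_num
  · rw [hd]
    simp only [eval_mul, eval_C, eval_X, eval_sub, eval_pow, one_pow, mul_one, one_mul]
    norm_num

/-! ## Self-inversive polynomials (Theorem 4.4.3) -/

/-- `P(z) = Σ_{k ≤ n} a_k zᵏ` for a polynomial of degree at most `n` (the coefficient form in which
Sheil-Small computes (4.171)–(4.173)). [cite: SheilSmall2002, §4.4.2 (4.171)–(4.173) (pp. 152–153)] -/
theorem eval_eq_sum {n : ℕ} (hpn : p.natDegree ≤ n) (z : ℂ) :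
    p.eval z = ∑ k ∈ range (n + 1), p.coeff k * z ^ k :=
  eval_eq_sum_range' (Nat.lt_succ_of_le hpn) z

/-- `zP'(z) = Σ_{k ≤ n} k a_k zᵏ` for a polynomial of degree at most `n` (so that
`nP(z) − zP'(z) = Σ (n − k) a_k zᵏ`, the first equality of (4.173)).
[cite: SheilSmall2002, §4.4.2 (4.173) (p. 153)] -/
theorem mul_eval_derivative_eq_sum {n : ℕ} (hpn : p.natDegree ≤ n) (z : ℂ) :
    z * p.derivative.eval z = ∑ k ∈ range (n + 1), p.coeff k * k * z ^ k := by
  have hd : p.derivative.natDegree < n + 1 :=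
    lt_of_le_of_lt ((natDegree_derivative_le p).trans (Nat.sub_le_of_le_add (hpn.trans (by omega))))
      (Nat.lt_succ_self n)
  have htop : p.coeff (n + 1) = 0 := coeff_eq_zero_of_natDegree_lt (Nat.lt_succ_of_le hpn)
  calc z * p.derivative.eval z = z * ∑ k ∈ range (n + 1), p.derivative.coeff k * z ^ k := by
        rw [eval_eq_sum_range' hd]
    _ = ∑ k ∈ range (n + 1), p.coeff (k + 1) * ((k : ℂ) + 1) * z ^ (k + 1) := by
        rw [Finset.mul_sum]
        refine Finset.sum_congr rfl fun k _ => ?_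
        rw [coeff_derivative]; ring
    _ = ∑ k ∈ range n, p.coeff (k + 1) * ((k : ℂ) + 1) * z ^ (k + 1) := by
        rw [Finset.sum_range_succ, htop, zero_mul, zero_mul, add_zero]
    _ = ∑ k ∈ range (n + 1), p.coeff k * k * z ^ k := by
        symm
        rw [Finset.sum_range_succ']
        simp only [Nat.cast_zero, mul_zero, zero_mul, add_zero, Nat.cast_succ]

/-- **(4.173)–(4.174)** For a self-inversive polynomial of degree at most `n`
(`a_k = conj a_{n−k}` for `k ≤ n`, Sheil-Small (4.170)) and `|z| = 1`:
`nP(z) − zP'(z) = zⁿ · conj(zP'(z))`, hence `|nP(z) − zP'(z)| = |P'(z)|`.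
[cite: SheilSmall2002, §4.4.2 (4.169)–(4.174) (pp. 152–153)] -/
theorem sub_eq_of_selfInversive {n : ℕ} (hpn : p.natDegree ≤ n)
    (hP : ∀ k ≤ n, p.coeff k = conj (p.coeff (n - k))) {z : ℂ} (hz : ‖z‖ = 1) :
    (n : ℂ) * p.eval z - z * p.derivative.eval z = z ^ n * conj (z * p.derivative.eval z) := by
  have hz0 : z ≠ 0 := by rintro rfl; simp at hz
  have hzinv : z⁻¹ = conj z := (Complex.inv_eq_conj hz)
  rw [eval_eq_sum hpn, mul_eval_derivative_eq_sum hpn, mul_sum, ← sum_sub_distrib, map_sum, mul_sum]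
  -- reflect the summation index `k ↦ n − k` on the left
  rw [← sum_range_reflect]
  refine sum_congr rfl fun k hk => ?_
  have hkn : k ≤ n := Nat.lt_succ_iff.1 (mem_range.1 hk)
  have hnk : n - (n - k) = k := Nat.sub_sub_self hkn
  simp only [show n + 1 - 1 - k = n - k from by omega, map_mul, map_natCast, map_pow]
  rw [hP (n - k) (Nat.sub_le n k), hnk, Nat.cast_sub hkn]
  -- `z^(n-k) = z^n * conj z ^ k` on the unit circle
  have hpow : z ^ (n - k) = z ^ n * conj z ^ k := by
    rw [← hzinv, inv_pow, ← div_eq_mul_inv, eq_div_iff (pow_ne_zero _ hz0), ← pow_add,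
      Nat.sub_add_cancel hkn]
  rw [hpow]
  ring

/-- **(4.174)** For a self-inversive polynomial of degree at most `n` and `|z| = 1`:
`|nP(z) − zP'(z)| = |P'(z)|`. [cite: SheilSmall2002, §4.4.2 (4.174) (p. 153)] -/
theorem norm_sub_eq_of_selfInversive {n : ℕ} (hpn : p.natDegree ≤ n)
    (hP : ∀ k ≤ n, p.coeff k = conj (p.coeff (n - k))) {z : ℂ} (hz : ‖z‖ = 1) :
    ‖(n : ℂ) * p.eval z - z * p.derivative.eval z‖ = ‖p.derivative.eval z‖ := by
  rw [sub_eq_of_selfInversive hpn hP hz, norm_mul, norm_pow, hz, one_pow, one_mul, Complex.norm_conj,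
    norm_mul, hz, one_mul]

/-- **Theorem 4.4.3 (inequality half):** a self-inversive polynomial of degree at most `n` with
`|P| ≤ M` on the unit circle satisfies `|P'(z)| ≤ (n/2)·M` for all `|z| ≤ 1` (on the circle
`2|P'| = |nP − zP'| + |P'| ≤ nM` by (4.174) and Theorem 4.4.2; inside by the maximum principle for `P'`).
[cite: SheilSmall2002, §4.4.3 Theorem (4.175) (p. 153)] -/
theorem selfInversive_le {n : ℕ} (hpn : p.natDegree ≤ n)
    (hP : ∀ k ≤ n, p.coeff k = conj (p.coeff (n - k))) {M : ℝ}
    (hM : ∀ w : ℂ, ‖w‖ = 1 → ‖p.eval w‖ ≤ M) {z : ℂ} (hz : ‖z‖ ≤ 1) :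
    ‖p.derivative.eval z‖ ≤ n / 2 * M := by
  have hcirc : ∀ w : ℂ, ‖w‖ = 1 → ‖p.derivative.eval w‖ ≤ n / 2 * M := by
    intro w hw
    have h := szego hpn hM hw.le
    rw [norm_sub_eq_of_selfInversive hpn hP hw] at h
    linarith
  exact norm_eval_le_of_forall_sphere (p := p.derivative) hcirc hz

/-- **Theorem 4.4.3 (equality half):** for a self-inversive polynomial of degree at most `n`, at each
point `z₀` of the unit circle where `|P(z₀)| = M = ‖P‖` one has `|P'(z₀)| = (n/2)M`; together with
`selfInversive_le`, `‖P'‖ = (n/2)‖P‖` and `|P'|` is maximal wherever `|P|` is. (This applies in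
particular when all zeros of `P` lie on the unit circle, after a unimodular normalisation.)
[cite: SheilSmall2002, §4.4.3 Theorem (4.175) and the sentence following it (p. 153)] -/
theorem selfInversive_eq {n : ℕ} (hpn : p.natDegree ≤ n)
    (hP : ∀ k ≤ n, p.coeff k = conj (p.coeff (n - k))) {M : ℝ}
    (hM : ∀ w : ℂ, ‖w‖ = 1 → ‖p.eval w‖ ≤ M) {z₀ : ℂ} (hz₀ : ‖z₀‖ = 1) (hzM : ‖p.eval z₀‖ = M) :
    ‖p.derivative.eval z₀‖ = n / 2 * M := by
  have h := szego_eq_of_norm_eq hpn hM hz₀ hzM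
  rw [norm_sub_eq_of_selfInversive hpn hP hz₀] at h
  linarith

/-- The example `P = 1 + zⁿ` of Theorem 4.4.3: it is self-inversive, `|P'| ≡ n` on the whole circle,
but `|P|` attains its maximum `2` only at the `n`-th roots of unity — e.g. for `n = 1`, at `z = −1`
one has `|P'(−1)| = 1 = ‖P'‖` while `|P(−1)| = 0 < 2`: «|P'| may have a maximum value at points where
|P| does not». [cite: SheilSmall2002, §4.4.3 example (p. 153)] -/
theorem selfInversive_example :
    (∀ k ≤ 1, (1 + X : ℂ[X]).coeff k = conj ((1 + X : ℂ[X]).coeff (1 - k))) ∧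
    ‖(derivative (1 + X : ℂ[X])).eval (-1)‖ = 1 ∧ ‖(1 + X : ℂ[X]).eval (-1)‖ = 0 := by
  refine ⟨fun k hk => ?_, by simp, by simp⟩
  interval_cases k <;> simp [coeff_one, coeff_X]

end Literature.Analysis.Complex.BernsteinLaxInequalities

end
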